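import Summits.BirchSwinnertonDyer.BirchSwinnertonDyer.Theses.PrintX6
import Literature.NumberTheory.EllipticCurves.Castella2018.TamagawaQuadraticBaseChangeProofs
import HarnessLib

/-!
# Route `PrintX6`, EDIT #4 Input item `InputCastella2018Sec5Tamagawa` — DISCHARGED (proved in the tree)

HONEST FRAMING (cell `bsd-print-x6`, run/shared/lean/pub/bsd-print-x6/; PRINT tier D-0131 (2);
prover p2, turnkey of seat ty2, INBOX 2026-08-27T17:00:50Z). THEOREMS ONLY; nothing about any
particular curve is asserted; BSD is not proved by any of this; no cell of the partition moves.

EDIT #4 of route `PrintX6` item-states every conjunct of the anticyclotomic pack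
`Supersingular.PublishedAcInputsX6Err` (seat ty2, p548175) as a by-name Input child of the crux
`EisensteinHalfFiveLe`. Conjunct (8), the Input item `InputCastella2018Sec5Tamagawa :=
Literature.NumberTheory.EllipticCurves.Castella2018.section5_tamagawaRelation` (Castella, Camb. J.
Math. 6 (2018) §5: the Tamagawa/torsion relation between `E/K` and `(E, E^{d_K})` over `ℚ` at an
erratum-type imaginary quadratic field), is not an open input: the named fact is DISCHARGED in the
tree by `Literature.NumberTheory.EllipticCurves.Castella2018.section5_tamagawaRelation_holds`
(`Literature/NumberTheory/EllipticCurves/Castella2018/TamagawaQuadraticBaseChangeProofs.lean`: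
Kodaira–Néron + Tate's algorithm per place, `p ≥ 5`; re-homed b2b proof). This file closes the item by
that theorem — tier PROVED, no flag. The other seven new Input children (newform existence, Mazur's
Manin-constant bound, Kobayashi 2013 Rem. 1.3, Castella 2018 Thm. 2.3, Cai–Shu–Tian 2014 Thm. 1.1,
the Friedberg–Hoffstein simple-zero supply, the CW24 Thm. 5.3 ∘ Cas18 Thm. 3.2 composite) remain
genuine named facts. [cite: Castella2018, §5 (arXiv:1704.06608 p. 12), Tamagawa relation]
-/

set_option autoImplicit false
-- the landed namespace `Summit.BirchSwinnertonDyer.BirchSwinnertonDyer.Theorems` (summit = problem) trips the linter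
set_option linter.dupNamespace false

namespace Summit.BirchSwinnertonDyer.BirchSwinnertonDyer.Theorems

/-- **Route `PrintX6`, Input item `InputCastella2018Sec5Tamagawa` (EDIT #4, pack conjunct (8)),
PROVED**: the named fact `Castella2018.section5_tamagawaRelation` holds — by the tree theorem
`Castella2018.section5_tamagawaRelation_holds` (Kodaira–Néron + Tate per place, `p ≥ 5`). Closes
the Input item; tier PROVED. [cite: Castella2018, §5 (arXiv:1704.06608 p. 12), Tamagawa relation] -/
theorem inputCastella2018Sec5Tamagawa_proof :
    Summit.BirchSwinnertonDyer.BirchSwinnertonDyer.Theses.PrintX6.InputCastella2018Sec5Tamagawa := by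
  unfold Summit.BirchSwinnertonDyer.BirchSwinnertonDyer.Theses.PrintX6.InputCastella2018Sec5Tamagawa
  exact Literature.NumberTheory.EllipticCurves.Castella2018.section5_tamagawaRelation_holds

end Summit.BirchSwinnertonDyer.BirchSwinnertonDyer.Theorems
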